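import Mathlib
import Literature.MathematicalPhysics.QuantumLattice.FermiRG.Salmhofer1998Sec6
import HarnessLib

/-!
# Salmhofer, *Continuous renormalization for fermions and Fermi liquid theory* (CMP 194 (1998) 249):
# §5.1 the component RGE in Fourier space AT FINITE VOLUME, §5.3 Lemma 3 (existence of the thermodynamic limit in
# perturbation theory), and §4.2 Proposition 3 (point singularities)

Companion to the typer files F7b `Salmhofer1998Sec2.lean`, F7c `Salmhofer1998Sec5.lean` and F7e `Salmhofer1998Sec6.lean`
of the cell `gate-hubbard-kl` (statements-first wave D-0069 (2); DAG rows `Sal98.L3` (Lemma 3, wave-optional licence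
F-084) and `Sal98.P3` (Proposition 3, licence F-082 — NOT used, see §3 below) of HOME/DAG.tsv).  The frozen files are
imported, not edited; every reused object keeps its home (`kappaSum`, `antisym`, `latticeMom`, `ModelData` — F7b;
`matsIdx`, `matsFreq`, `cutoffCov`, `cutoffCovDot`, `IsCutoff`, `epsT` — F7c; `Leg`, `FMom`, `MomFamily`, `supNorm`,
`legProp`, `legFlip`, `mfDeg`, `selAll`, `loopInt`, `momQuadTerm`, `IsMomRGESolution` — F7e).

Source: M. Salmhofer, Commun. Math. Phys. **194** (1998) 249–295, arXiv:cond-mat/9706188 [Salmhofer1998]; locators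
`p.N Ln` = chunk `pNNNN.txt` line `n` of the materialised arXiv TeX (`lit read arxiv:cond-mat/9706188`; cell render
HOME/dag/texts/paper-arxiv-cond-mat_9706188), NOT printed pages: §5 ¶2–3 p.17 L22–40; §5.1 p.17 L42 – p.18 L6 ((5.6)
`\Qfour` p.17 L139–152, Remark 5 `\equinteFou` p.17 L156–163); §5.3 p.18 L106–136; Lemma 3 (`\tdlemma`) p.18 L138 –
p.19 L7, proof p.19 L9–69, Remark 7 p.19 L71–81; §4.2 Proposition 3 (`\GNtoy`) p.15 L136–150, proof p.15 L152–178,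
Remark 3 p.15 L180 – p.16 L23.

## §1 The component RGE in Fourier space at finite `(n_τ, L)` (p.17 L42 – p.18 L6)

F7e types the bilinear term `Q_{m,r}(t | P)` of (5.6) in the THERMODYNAMIC LIMIT (`momQuadTerm`: loop variables
integrated over `ℝ × 𝓑` through `ω_β`, `loopInt`).  Lemma 3 is about the same equation at FINITE `n_τ` and `L`, where
`∫ dK = Σ_{σ,j} ∫_{Λ*} dk` is the Riemann sum `∫_{Λ*} dk = β⁻¹ Σ_{ω ∈ 𝕄_{n_τ}} L^{-d} Σ_{𝐤 ∈ Λ*_L}` (p.6 L80–83; F7c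
`momSum`) and the propagator is the finite-volume (5.9) with `ω̂` (F7c `cutoffCov`).  To type it WITHOUT restating the
25-line body of `momQuadTerm`, the loop integration is abstracted: `momQuadTermWith LI` is F7e's definition with the
functional `LI n F` in place of `loopInt latt β n F`, `momQuadTerm = momQuadTermWith (loopInt latt β)` holds by `rfl`
(`momQuadTerm_eq_momQuadTermWith`), and the finite-volume instance is `LI = loopSum latt β n_τ L` (`momQuadTermFin`,
`IsMomRGESolutionFin`).  The external momenta stay continuous (`P ∈ ((ℝ × 𝓑) × {±} × {1,2})^m`): "the integral defines
the `t`-derivative of a function defined on `Γ∞^m`" (p.18 L114–118), which is how print compares different `(n_τ, L)`.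

## §2 Lemma 3 (p.18 L138 – p.19 L7) — typed as the named fact `PerturbativeThermodynamicLimit` (licence F-084)

Standing assumptions of §5 made explicit (as in F7c's `FiniteVolumePropagatorBounds`): the §2.3 class of models
(`ModelData.Hyp`), a cutoff `χ₁` (`IsCutoff`), `E_max`, the volume constant `V₀` of (2.?) `\Vobou` (F7b names it `V₁`),
`βε₀ ≥ 6` ("the factor `6^{1-r}` comes from the assumption `βε₀ ≥ 6`", p.19 L63–64), `n_τ` even with
`n_τ ≥ 2β(ε₀ + E_max)` ("Since I want to take the limit `n_τ → ∞`, I can assume …", p.17 L38–40).  The family is indexed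
by `(n, L)` with `n_τ = 2n` (evenness built in); `lim_{(n_τ,L)→∞} = lim_{L→∞} lim_{n_τ→∞}` (p.18 L134–136) is the
iterated pointwise limit `IteratedLimit`.  The polynomials `P_{mr}` of (5.?) `\polymr` are typed as the predicate
`IsLemma3Poly` (like F7b's `IsTruncatedGamma`, F7e's `IsSkeletonK`).

Flags (disclosed readings).  (L3-1) `\polymr` prints `6^{1-r}|I_{rm}(0)|` (p.18 L159): read as the ASSUMED uniform bound
`K^{(0)}_{mr}` of the hypothesis `|I^{(n_τ,L)}_{mr}(0)| ≤ K^{(0)}_{mr}` — with the literal reading (the sup norm of the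
LIMIT datum) the case `r = 1` of (5.?) `\ih4`, `|I^{(n_τ,L)}_{m1}(t)|_0 = |I^{(n_τ,L)}_{m1}(0)|_0 ≤ P_{m1} = |I_{m1}(0)|_0`,
fails whenever a finite-volume datum exceeds the norm of its limit, while the printed proof ("the statement follows from
the hypotheses on `I^{(n_τ,L)}_{mr}(0)`", p.19 L14–15) uses exactly `K^{(0)}`.  (L3-2) `\ih2` prints `t > log(β/2)`
(p.18 L150) where the proof gives `log(βε₀/2)` (p.19 L66–67); `ε₀ ≤ 1` makes the printed clause the weaker one — typed
as printed.  (L3-3) "bounded functions" (p.18 L140, L153) = finite sup norm (`supNorm < ⊤`); the limits are pointwise in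
`P ∈ Γ∞^m` (print does not name a topology; the proof's dominated convergence is pointwise).  (L3-4) `\ih4` "for all
`n_τ, L, β, t`": typed for the admissible `(n_τ, L)` of §5 ¶3, the `β` of the standing window and `t ≥ 0`.

## §3 Proposition 3 (§4.2, p.15 L136–150) — objects typed, the printed bounds PROVED pointwise; NO named fact

Print: "Let `D_t` be given by (4.6) with `‖M(k)‖ ≤ 1`, `f(0) = 0`, and for `k ≠ 0`, `f(k) = 𝔣(k) χ₁(e^{2t} 𝔣(k)²)`, with
`𝔣 ∈ C^{d+1}(𝓑 ∖ {0}, ℂ)` satisfying `|D^α 𝔣(k)| ≤ F_d |k|^{1-d-|α|}` (`|α| ≤ d+1`, `|k| ≤ 1`).  Then (4.14) and (4.15)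
hold" — `∫_{Λ*} dk |D̂_t(k)| ≤ Δ₁ e^{-t}` and `‖Ḋ_t‖ ≤ Δ₂ e^{t}`.  Two findings, recorded instead of a fact:
(P3-1) the STATEMENT's cutoff `χ₁(e^{2t}𝔣(k)²)` restricts to `|𝔣(k)| ≤ e^{-t}`, i.e. (for `𝔣 ~ |k|^{1-d}`) to LARGE
`|k|`, whereas the PROOF's first line integrates `|k|^{1-d} χ₁(k² e^{2t})` (p.15 L153–156), the infrared cutoff
`|k| ≤ e^{-t}`; (P3-2) with the statement's cutoff both printed bounds hold for EVERY function `𝔣` on the finite momentum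
set, with lattice-dependent constants, by a two-line support argument — on the support `e^{2t}|𝔣|² < 1` one has
`|f_t(k)| ≤ |𝔣(k)| < e^{-t}` and `|∂_t f_t(k)| = 2e^{2t}|𝔣|³|χ₁'| ≤ 4e^{-t}` — which is what `norm_pointCutoff_le`,
`norm_pointCutoffDot_le`, `hasDerivAt_pointCutoff` and `einnorm_pointCutoff` / `sum_norm_pointCutoffDot_le` below PROVE
(the hypothesis shape `ε_* Σ_k |D̂_t(k)| ≤ Δ₁e^{-t}` of F7b's `TruncatedPowerCounting`, with `Δ₁ = ε_*|Λ*|`; the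
position-space `‖Ḋ_t‖ ≤ Δ₂e^{t}` then follows per fixed `Γ` from `|χ_k| = 1`, `|M_{σσ'}| ≤ 1` with `Δ₂ = 4ε|Γ|ε_*|Λ*|`, not
typed).  The printed proof's `L`-UNIFORM constants need the summation-by-parts decay (p.15 L157–178), hence regularity
of `M(k)` that the statement does not assume.  No faithful non-trivial closed `Prop` results; licence F-082 stays unused
(cell GAP-class record `Sal98.P3`).

No `instance`, no `notation`; nothing about the Hubbard model is asserted or denied; no sorry/axiom.
-/

noncomputable section

open MeasureTheory Filter
open scoped Topology ENNReal

namespace Literature.MathematicalPhysics.QuantumLattice.FermiRG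

namespace Salmhofer1998

variable {d : ℕ}

/-! ### §1 The bilinear term with an abstract loop integration; the finite-volume instance -/

/-- F7e's bilinear term (5.6) `Q_{m,r}(t | P)` with the loop integration `∫ dK₂…dK_i` abstracted into a functional
`LI n F` on `n`-leg integrands (`LI = loopInt latt β` gives back `momQuadTerm`, `momQuadTerm_eq_momQuadTermWith`;
`LI = loopSum latt β n_τ L` is the finite-volume Riemann sum of §5.1).  Body verbatim F7e's (selector `sel`, `∫dκ_{mr}` =
F7b `kappaSum` with `m̄(r) = 2r+2`, `k₁` fixed by momentum conservation, vertex 2 fed `∼K` reversed).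
[cite: Salmhofer1998, §5.1 (5.6) (p.17 L135–152)] -/
def momQuadTermWith (LI : (n : ℕ) → ((Fin n → Leg d) → ℂ) → ℂ) (sel : ℕ → ℕ → ℕ → ℕ → Bool)
    (C Cdot : ℝ → FMom d → ℂ) (I₁ I₂ : MomFamily d) (m r : ℕ) (t : ℝ) (P : Fin m → Leg d) : ℂ :=
  kappaSum mfDeg m r fun r₁ m₁ r₂ m₂ i =>
    if h : i ≤ m₁ ∧ i ≤ m₂ ∧ m₁ + m₂ = m + 2 * i then
      if sel m m₁ m₂ i then
        (((i.factorial * i : ℕ) : ℝ) : ℂ) *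
          LI (i - 1) fun K : Fin (i - 1) → Leg d =>
            ∑ sj₁ : Fin 2 × Fin 2,
              (-(legProp Cdot t
                  ((-(∑ s, (K s).1) + ∑ μ : Fin (m₁ - i), (P ⟨μ.val, by omega⟩).1), sj₁))) *
                (∏ s, legProp C t (K s)) *
                I₁ m₁ r₁ t (fun j : Fin m₁ =>
                  if hj : j.val < m₁ - i then P ⟨j.val, by omega⟩
                  else if hj' : j.val = m₁ - i then
                    ((-(∑ s, (K s).1) + ∑ μ : Fin (m₁ - i), (P ⟨μ.val, by omega⟩).1), sj₁)
                  else K ⟨j.val - (m₁ - i) - 1, by omega⟩) *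
                I₂ m₂ r₂ t (fun j : Fin m₂ =>
                  if hj : j.val < i - 1 then legFlip (K ⟨(i - 2) - j.val, by omega⟩)
                  else if hj' : j.val = i - 1 then
                    legFlip ((-(∑ s, (K s).1) + ∑ μ : Fin (m₁ - i), (P ⟨μ.val, by omega⟩).1), sj₁)
                  else P ⟨(m₁ - i) + (j.val - i), by omega⟩)
      else 0
    else 0

/-- F7e's `momQuadTerm` IS `momQuadTermWith` at the thermodynamic-limit loop integration `loopInt latt β`.
[cite: Salmhofer1998, §5.1 (5.6) (p.17 L135–152)] -/
theorem momQuadTerm_eq_momQuadTermWith (latt β : ℝ) (sel : ℕ → ℕ → ℕ → ℕ → Bool) (C Cdot : ℝ → FMom d → ℂ)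
    (I₁ I₂ : MomFamily d) :
    momQuadTerm latt β sel C Cdot I₁ I₂ = momQuadTermWith (loopInt latt β) sel C Cdot I₁ I₂ := rfl

/-- **`∫ dK₁ ⋯ dK_n` at finite `(n_τ, L)`**: `∫_{Γ*} dK = Σ_{σ,j} ∫_{Λ*} dk` with the Riemann sum
`∫_{Λ*} dk F = β⁻¹ Σ_{ω ∈ 𝕄_{n_τ}} L^{-d} Σ_{𝐤 ∈ Λ*_L} F(ω, 𝐤)` (p.6 L80–83, p.17 L44–47; F7c `matsIdx`/`matsFreq`, F7b
`latticeMom`), over `n` loop legs. [cite: Salmhofer1998, §2.2 (p.6 L80–83) and §5.1 (p.17 L44–47, L139–141)] -/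
def loopSum (latt β : ℝ) (nτ L : ℕ) (n : ℕ) (F : (Fin n → Leg d) → ℂ) : ℂ :=
  ∑ sj : Fin n → Fin 2 × Fin 2, ∑ ns ∈ Fintype.piFinset (fun _ : Fin n => matsIdx nτ),
    ∑ qs : Fin n → (Fin d → Fin L),
      (((β⁻¹ * ((L : ℝ) ^ d)⁻¹) ^ n : ℝ) : ℂ) *
        F (fun s => ((matsFreq β (ns s), latticeMom latt L (qs s)), sj s))

/-- **The bilinear term (5.6) at finite `(n_τ, L)`**: `momQuadTermWith` at the Riemann sum `loopSum`.
[cite: Salmhofer1998, §5.1 (5.6) (p.17 L135–152)] -/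
def momQuadTermFin (latt β : ℝ) (nτ L : ℕ) (sel : ℕ → ℕ → ℕ → ℕ → Bool) (C Cdot : ℝ → FMom d → ℂ)
    (I₁ I₂ : MomFamily d) : (m : ℕ) → ℕ → ℝ → (Fin m → Leg d) → ℂ :=
  momQuadTermWith (loopSum latt β nτ L) sel C Cdot I₁ I₂

/-- **Remark 5 (`\equinteFou`, p.17 L156–163) at finite `(n_τ, L)`**: `I_{m,r}(t | P) = I_{m,r}(0 | P) +
½ 𝔸_m ∫_0^t ds Q_{m,r}(s | P)` for `t ≥ 0` and all external `P` (continuous external momenta, p.18 L114–118), with the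
finite-volume bilinear term; "together with an initial condition … uniquely determines the family" (p.18 L1–5).
[cite: Salmhofer1998, Remark 5 (p.17 L156 – p.18 L6)] -/
def IsMomRGESolutionFin (latt β : ℝ) (nτ L : ℕ) (sel : ℕ → ℕ → ℕ → ℕ → Bool) (C Cdot : ℝ → FMom d → ℂ)
    (I : MomFamily d) : Prop :=
  ∀ (m r : ℕ) (t : ℝ), 0 ≤ t → ∀ P : Fin m → Leg d,
    I m r t P = I m r 0 P +
      (2 : ℂ)⁻¹ * antisym (fun P' => ∫ s in (0 : ℝ)..t, momQuadTermFin latt β nτ L sel C Cdot I I m r s P') P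

/-- The finite-volume propagator (5.9) as a scale family on `(ω, 𝐤)`: `(t, (ω, 𝐤)) ↦ D̃_t(ω, 𝐤)` with `ω̂` at time-lattice
spacing `β/n_τ` (F7c `cutoffCov`; read at `ω ∈ 𝕄_{n_τ}`, `𝐤 ∈ Λ*_L` by `loopSum`). [cite: Salmhofer1998, §5.2 (5.9) (p.18 L27–36)] -/
def finVolProp (M : ModelData d) (χ₁ : ℝ → ℝ) (β : ℝ) (nτ : ℕ) : ℝ → FMom d → ℂ :=
  fun t k => cutoffCov M χ₁ β nτ t k.1 k.2

/-- Its `t`-derivative `∂_t D̃_t` (F7c `cutoffCovDot`). [cite: Salmhofer1998, §5.2 (p.18 L40–41)] -/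
def finVolPropDot (M : ModelData d) (χ₁ : ℝ → ℝ) (β : ℝ) (nτ : ℕ) : ℝ → FMom d → ℂ :=
  fun t k => cutoffCovDot M χ₁ β nτ t k.1 k.2

/-! ### §2 Lemma 3: existence of the thermodynamic limit in perturbation theory (`Sal98.L3`, F-084) -/

/-- A leg configuration `P ∈ Γ∞^m`, `Γ∞ = 𝕄(β) × 𝓑 × {-1,1} × {1,2}` (p.18 L116–125): every frequency is a
fermionic Matsubara frequency `ω_n = (π/β)(2n+1)` (F7c `matsFreq`; F7e's carrier `Leg d` allows any real frequency —
print's functions live on `Γ∞^m`, and the `β`-cutoff of Proposition 4 acts only there).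
[cite: Salmhofer1998, §5.3 (5.12) (p.18 L116–125)] -/
def IsMatsConfig (β : ℝ) {m : ℕ} (P : Fin m → Leg d) : Prop :=
  ∀ μ : Fin m, ∃ n : ℤ, (P μ).1.1 = matsFreq β n

/-- `lim_{(n_τ,L)→∞} a_{n_τ,L} = lim_{L→∞} lim_{n_τ→∞} a_{n_τ,L} = c` (p.18 L134–136), for a double sequence indexed by
`(n, L)` with `n_τ = 2n`: the inner limits exist for every `L ≥ 1` and their sequence tends to `c`.
[cite: Salmhofer1998, §5.3 (p.18 L134–136)] -/
def IteratedLimit (a : ℕ → ℕ → ℂ) (c : ℂ) : Prop :=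
  ∃ b : ℕ → ℂ, (∀ L : ℕ, 1 ≤ L → Tendsto (fun n => a n L) atTop (𝓝 (b L))) ∧ Tendsto b atTop (𝓝 c)

/-- **The polynomials `P_{mr}` of Lemma 3** ((5.?) `\polymr`, p.18 L157–162): `P_{mr}(x) = 6^{1-r} K^{(0)}_{mr} +
ε₀⁻¹ ∫dκ_{mr} i·i!·x^{i-1} P_{m₁r₁}(x) P_{m₂r₂}(x)` (full measure `∫dκ_{mr}`, `m̄(r) = 2r+2`; the recursion determines
`P` uniquely by induction on `r`; "the coefficients of `P_{mr}` are independent of `β`", p.19 L1).  Print writes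
`|I_{rm}(0)|` for the constant term — read as the assumed uniform bound `K^{(0)}_{mr}` (module docstring, flag L3-1).
Typed as the predicate "`P` satisfies `\polymr`". [cite: Salmhofer1998, Lemma 3 (p.18 L157 – p.19 L1)] -/
def IsLemma3Poly (eps0 : ℝ) (K0 : ℕ → ℕ → ℝ) (P : ℕ → ℕ → ℝ → ℝ) : Prop :=
  ∀ (m r : ℕ) (x : ℝ),
    P m r x = (6 : ℝ)⁻¹ ^ (r - 1) * K0 m r +
      eps0⁻¹ * Complex.re (kappaSum mfDeg m r fun r₁ m₁ r₂ m₂ i =>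
        ((((i * i.factorial : ℕ) : ℝ) * x ^ (i - 1) * P m₁ r₁ x * P m₂ r₂ x : ℝ) : ℂ))

/-- **Lemma 3 (`\tdlemma`, p.18 L138 – p.19 L7), existence of the thermodynamic limit in perturbation theory**, as
printed, with the standing assumptions of §5 explicit (module docstring §2).  DATA: a many-fermion model `M` of the
§2.3 class with cutoff `χ₁`, `E_max ≥ |E|`, the volume constant `V₀` (`L'^{-d} #{𝐤 ∈ Λ*_{L'} : |E(𝐤)| ≤ 2} ≤ V₀`), `β`
with `βε₀ ≥ 6`; a family `I n L` of solutions of the finite-volume RGE (`IsMomRGESolutionFin` with the propagator (5.9)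
at `n_τ = 2n`, for every admissible `(n, L)`: `2n ≥ 2β(ε₀ + E_max)`, `L ≥ 1`) whose initial data are bounded functions
with `I^{(n_τ,L)}_{mr}(0) = 0` for `m > 2r+2`, `|I^{(n_τ,L)}_{mr}(0)|_0 ≤ K^{(0)}_{mr}`, and
`lim_{(n_τ,L)→∞} I^{(n_τ,L)}_{mr}(0 | P) = I_{mr}(0 | P)` pointwise on `Γ∞^m` with `I_{mr}(0)` bounded there.  CONCLUSIONS:
for all `m, r` and admissible `(n, L)`: (ih1) `I^{(n_τ,L)}_{mr}(t) = 0` if `m > 2r+2` (`t ≥ 0`); (ih2) `∂_t I^{(n_τ,L)}_{mr}(t | P)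
= 0` for all `t > log(β/2)` and `P ∈ Γ∞^m`; (ih3) there are functions `I_{mr}(t)`, bounded on `Γ∞^m`, with
`lim_{(n_τ,L)→∞} I^{(n_τ,L)}_{mr}(t | P) = I_{mr}(t | P)` (`t ≥ 0`, pointwise on `Γ∞^m`); (ih4) for the polynomials `P_{mr}` of
`\polymr`: `|I^{(n_τ,L)}_{mr}(t)|_0 ≤ (ε₀β)^{r-1} P_{mr}(4V₀ log(βε₀/2))` for all admissible `(n_τ, L)` and `t ≥ 0`, `|·|_0`
the sup over `Γ∞^m` (typed pointwise at every `P ∈ Γ∞^m`).  `Γ∞^m` = Matsubara external frequencies (`IsMatsConfig`):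
F7e's carrier allows arbitrary real frequencies, at which the finite-volume propagator (5.9) (`ω̂` periodic) is not cut
off by `β`, so (ih2)/(ih4) are — as in print — statements on `Γ∞^m`.  Wave-optional named fact (D-0014, licence F-084);
nothing is instantiated at the Hubbard model. `Sal98.L3` · Salmhofer 1998 Lemma 3 ·
p.18 L138 – p.19 L7. [cite: Salmhofer1998, Lemma 3 (p.18 L138 – p.19 L7)] -/
def PerturbativeThermodynamicLimit : Prop :=
  ∀ (d : ℕ) (M : ModelData d), M.Hyp →
  ∀ (χ₁ : ℝ → ℝ), IsCutoff χ₁ →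
  ∀ (Emax V₀ β : ℝ),
    (∀ p : Mom d, |M.E p| ≤ Emax) →
    (∀ L' : ℕ, 0 < L' →
      ((Finset.univ.filter fun q : Fin d → Fin L' => |M.E (latticeMom M.latt L' q)| ≤ 2).card : ℝ) /
          (L' : ℝ) ^ d ≤ V₀) →
    0 < β → 6 ≤ β * M.eps0 →
  ∀ (I : ℕ → ℕ → MomFamily d) (I0lim : (m : ℕ) → ℕ → (Fin m → Leg d) → ℂ) (K0 : ℕ → ℕ → ℝ),
    -- the finite-volume families solve (5.6)/Remark 5 with the propagator (5.9), `n_τ = 2n`, admissible `(n, L)`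
    (∀ n L : ℕ, 2 * β * (M.eps0 + Emax) ≤ 2 * n → 1 ≤ L →
      IsMomRGESolutionFin M.latt β (2 * n) L selAll (finVolProp M χ₁ β (2 * n)) (finVolPropDot M χ₁ β (2 * n))
        (I n L)) →
    -- hypotheses on the initial data (p.18 L138–143), on `Γ∞^m`
    (∀ (n L m r : ℕ), 2 * r + 2 < m → ∀ P : Fin m → Leg d, I n L m r 0 P = 0) →
    (∀ m r : ℕ, 0 ≤ K0 m r) →
    (∀ (n L m r : ℕ) (P : Fin m → Leg d), IsMatsConfig β P → ‖I n L m r 0 P‖ ≤ K0 m r) →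
    (∀ (m r : ℕ) (P : Fin m → Leg d), IsMatsConfig β P → IteratedLimit (fun n L => I n L m r 0 P) (I0lim m r P)) →
    (∀ m r : ℕ, ∃ B : ℝ, ∀ P : Fin m → Leg d, IsMatsConfig β P → ‖I0lim m r P‖ ≤ B) →
    -- conclusions
    (∀ n L : ℕ, 2 * β * (M.eps0 + Emax) ≤ 2 * n → 1 ≤ L →
      ∀ (m r : ℕ) (t : ℝ), 0 ≤ t →
        -- (ih1)
        (2 * r + 2 < m → ∀ P : Fin m → Leg d, I n L m r t P = 0) ∧
        -- (ih2)
        (Real.log (β / 2) < t → ∀ P : Fin m → Leg d, IsMatsConfig β P →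
          HasDerivAt (fun s => I n L m r s P) 0 t)) ∧
    -- (ih3)
    (∃ Ilim : MomFamily d,
      (∀ (m r : ℕ) (t : ℝ), 0 ≤ t → ∃ B : ℝ, ∀ P : Fin m → Leg d, IsMatsConfig β P → ‖Ilim m r t P‖ ≤ B) ∧
      ∀ (m r : ℕ) (t : ℝ), 0 ≤ t → ∀ P : Fin m → Leg d, IsMatsConfig β P →
        IteratedLimit (fun n L => I n L m r t P) (Ilim m r t P)) ∧
    -- (ih4)
    (∀ P₃ : ℕ → ℕ → ℝ → ℝ, IsLemma3Poly M.eps0 K0 P₃ →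
      ∀ n L : ℕ, 2 * β * (M.eps0 + Emax) ≤ 2 * n → 1 ≤ L →
        ∀ (m r : ℕ) (t : ℝ), 0 ≤ t → ∀ P : Fin m → Leg d, IsMatsConfig β P →
          ‖I n L m r t P‖ ≤ (M.eps0 * β) ^ (r - 1) * P₃ m r (4 * V₀ * Real.log (β * M.eps0 / 2)))

/-! ### §3 Proposition 3 (§4.2): the point-singularity cutoff and its printed bounds, pointwise (no named fact) -/

/-- **The cutoff covariance of Proposition 3** (p.15 L140–143), on a finite momentum set `Λ*` with zero momentum `k₀`:
`f_t(0) = 0` and `f_t(k) = 𝔣(k) χ₁(e^{2t} |𝔣(k)|²)` for `k ≠ 0` — the scalar `D̂_t` of the form (4.6) (F7b `DForm`, slot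
`Dhat`).  Print writes `𝔣(k)²` for complex `𝔣`; `χ₁` takes nonnegative reals, so `|𝔣(k)|²` is read (module docstring
§3, findings P3-1/P3-2). [cite: Salmhofer1998, Proposition 3 (p.15 L136–150)] -/
def pointCutoff {Λs : Type*} [DecidableEq Λs] (χ₁ : ℝ → ℝ) (k0 : Λs) (𝔣 : Λs → ℂ) (t : ℝ) (k : Λs) : ℂ :=
  if k = k0 then 0 else 𝔣 k * (χ₁ (Real.exp (2 * t) * ‖𝔣 k‖ ^ 2) : ℂ)

/-- Its `t`-derivative, `∂_t f_t(k) = 𝔣(k) χ₁'(e^{2t}|𝔣(k)|²) · 2e^{2t}|𝔣(k)|²` (`k ≠ 0`), `0` at `k₀`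
(`hasDerivAt_pointCutoff`). [cite: Salmhofer1998, Proposition 3 (p.15 L136–150)] -/
def pointCutoffDot {Λs : Type*} [DecidableEq Λs] (χ₁ : ℝ → ℝ) (k0 : Λs) (𝔣 : Λs → ℂ) (t : ℝ) (k : Λs) : ℂ :=
  if k = k0 then 0
  else 𝔣 k * ((deriv χ₁ (Real.exp (2 * t) * ‖𝔣 k‖ ^ 2) * (2 * Real.exp (2 * t) * ‖𝔣 k‖ ^ 2) : ℝ) : ℂ)

section PointSingularity

variable {Λs : Type*} [DecidableEq Λs] {χ₁ : ℝ → ℝ}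

omit [DecidableEq Λs] in
/-- On the support of the printed cutoff: if `e^{2t}|𝔣(k)|² ≤ 1` then `|𝔣(k)| ≤ e^{-t}`.
[cite: Salmhofer1998, Proposition 3 (p.15 L140–143)] -/
theorem norm_le_exp_neg_of_arg_le_one {𝔣 : Λs → ℂ} {t : ℝ} {k : Λs}
    (h : Real.exp (2 * t) * ‖𝔣 k‖ ^ 2 ≤ 1) : ‖𝔣 k‖ ≤ Real.exp (-t) := by
  have hpos : 0 < Real.exp t := Real.exp_pos t
  have e2 : Real.exp t ^ 2 = Real.exp (2 * t) := by
    rw [← Real.exp_nat_mul]; norm_num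
  have hsq : (Real.exp t * ‖𝔣 k‖) ^ 2 ≤ 1 := by rw [mul_pow, e2]; exact h
  have h0 : 0 ≤ Real.exp t * ‖𝔣 k‖ := mul_nonneg hpos.le (norm_nonneg _)
  have h1 : Real.exp t * ‖𝔣 k‖ ≤ 1 := by nlinarith
  calc ‖𝔣 k‖ = Real.exp (-t) * (Real.exp t * ‖𝔣 k‖) := by
        rw [← mul_assoc, ← Real.exp_add, neg_add_cancel, Real.exp_zero, one_mul]
    _ ≤ Real.exp (-t) * 1 := by gcongr
    _ = Real.exp (-t) := mul_one _

/-- A cutoff `χ₁` as in §4.1 has `χ₁' = 0` beyond `1` (it vanishes identically on `[1, ∞)`).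
[cite: Salmhofer1998, §4.1 (p.15 L125–134)] -/
theorem deriv_cutoff_eq_zero_of_one_lt (hχ : IsCutoff χ₁) {x : ℝ} (hx : 1 < x) : deriv χ₁ x = 0 := by
  have h : χ₁ =ᶠ[𝓝 x] fun _ => (0 : ℝ) := by
    filter_upwards [Ioi_mem_nhds hx] with y hy using hχ.eq_zero y (le_of_lt hy)
  rw [h.deriv_eq, deriv_const]

/-- **(4.14) pointwise, as printed in Proposition 3**: `|f_t(k)| ≤ e^{-t}` for every `k` and every function `𝔣` — on the
support of `χ₁(e^{2t}|𝔣|²)` one has `|𝔣(k)| < e^{-t}` (finding P3-2 of the module docstring).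
[cite: Salmhofer1998, Proposition 3 (p.15 L136–150)] -/
theorem norm_pointCutoff_le (hχ : IsCutoff χ₁) (k0 : Λs) (𝔣 : Λs → ℂ) (t : ℝ) (k : Λs) :
    ‖pointCutoff χ₁ k0 𝔣 t k‖ ≤ Real.exp (-t) := by
  unfold pointCutoff
  split_ifs with hk
  · rw [norm_zero]; exact (Real.exp_pos _).le
  · set x := Real.exp (2 * t) * ‖𝔣 k‖ ^ 2 with hx
    have hx0 : 0 ≤ x := by positivity
    by_cases h1 : 1 ≤ x
    · rw [hχ.eq_zero x h1, Complex.ofReal_zero, mul_zero, norm_zero]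
      exact (Real.exp_pos _).le
    · replace h1 : x < 1 := lt_of_not_ge h1
      have hχx := hχ.mem_Icc x hx0
      have habs : ‖(χ₁ x : ℂ)‖ ≤ 1 := by
        rw [Complex.norm_real, Real.norm_eq_abs, abs_le]
        exact ⟨by linarith [hχx.1], hχx.2⟩
      calc ‖𝔣 k * (χ₁ x : ℂ)‖ = ‖𝔣 k‖ * ‖(χ₁ x : ℂ)‖ := norm_mul _ _
        _ ≤ Real.exp (-t) * 1 := by
          gcongr
          exact norm_le_exp_neg_of_arg_le_one h1.le
        _ = Real.exp (-t) := mul_one _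

/-- **The `t`-derivative bound behind (4.15), as printed in Proposition 3**: `|∂_t f_t(k)| ≤ 4e^{-t}` for every `k` and
every `𝔣` (`‖χ₁'‖_∞ ≤ 2`, `χ₁' = 0` off `(¼, 1)`, and `|𝔣(k)| ≤ e^{-t}` on the support; finding P3-2).
[cite: Salmhofer1998, Proposition 3 (p.15 L136–150)] -/
theorem norm_pointCutoffDot_le (hχ : IsCutoff χ₁) (k0 : Λs) (𝔣 : Λs → ℂ) (t : ℝ) (k : Λs) :
    ‖pointCutoffDot χ₁ k0 𝔣 t k‖ ≤ 4 * Real.exp (-t) := by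
  have h4 : (0 : ℝ) ≤ 4 * Real.exp (-t) := by positivity
  unfold pointCutoffDot
  split_ifs with hk
  · rwa [norm_zero]
  · by_cases hf : 𝔣 k = 0
    · rw [hf, zero_mul, norm_zero]; exact h4
    · set x := Real.exp (2 * t) * ‖𝔣 k‖ ^ 2 with hx
      have hxpos : 0 < x := mul_pos (Real.exp_pos _) (pow_pos (norm_pos_iff.mpr hf) 2)
      have hc : 2 * Real.exp (2 * t) * ‖𝔣 k‖ ^ 2 = 2 * x := by rw [hx]; ring
      rw [hc]
      by_cases hx1 : 1 < x
      · rw [deriv_cutoff_eq_zero_of_one_lt hχ hx1, zero_mul, Complex.ofReal_zero, mul_zero, norm_zero]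
        exact h4
      · replace hx1 : x ≤ 1 := le_of_not_gt hx1
        have hd : |deriv χ₁ x| ≤ 2 := hχ.deriv_bound x hxpos
        have hF : ‖𝔣 k‖ ≤ Real.exp (-t) := norm_le_exp_neg_of_arg_le_one hx1
        have h2x : (0 : ℝ) ≤ 2 * x := by positivity
        calc ‖𝔣 k * ((deriv χ₁ x * (2 * x) : ℝ) : ℂ)‖ = ‖𝔣 k‖ * (|deriv χ₁ x| * (2 * x)) := by
              rw [norm_mul, Complex.norm_real, Real.norm_eq_abs, abs_mul, abs_of_nonneg h2x]
          _ ≤ Real.exp (-t) * (2 * (2 * 1)) := by gcongr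
          _ = 4 * Real.exp (-t) := by ring

/-- `∂_t f_t(k)` IS the derivative of `t ↦ f_t(k)` (chain rule; `χ₁` is differentiable at every `x > 0` by `IsCutoff.smooth`).
[cite: Salmhofer1998, Proposition 3 (p.15 L136–150)] -/
theorem hasDerivAt_pointCutoff (hχ : IsCutoff χ₁) (k0 : Λs) (𝔣 : Λs → ℂ) (t : ℝ) (k : Λs) :
    HasDerivAt (fun s => pointCutoff χ₁ k0 𝔣 s k) (pointCutoffDot χ₁ k0 𝔣 t k) t := by
  unfold pointCutoff pointCutoffDot
  by_cases hk : k = k0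
  · simp only [hk, if_true]
    exact hasDerivAt_const t (0 : ℂ)
  · simp only [hk, if_false]
    by_cases hf : 𝔣 k = 0
    · simp only [hf, zero_mul]
      exact hasDerivAt_const t (0 : ℂ)
    · have hx : 0 < Real.exp (2 * t) * ‖𝔣 k‖ ^ 2 := mul_pos (Real.exp_pos _) (pow_pos (norm_pos_iff.mpr hf) 2)
      have h_lin : HasDerivAt (fun s : ℝ => 2 * s) 2 t := by
        simpa using (hasDerivAt_id t).const_mul (2 : ℝ)
      have h_exp : HasDerivAt (fun s : ℝ => Real.exp (2 * s)) (Real.exp (2 * t) * 2) t := h_lin.exp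
      have h_inner : HasDerivAt (fun s : ℝ => Real.exp (2 * s) * ‖𝔣 k‖ ^ 2)
          (2 * Real.exp (2 * t) * ‖𝔣 k‖ ^ 2) t := by
        have h := h_exp.mul_const (‖𝔣 k‖ ^ 2)
        have e : Real.exp (2 * t) * 2 * ‖𝔣 k‖ ^ 2 = 2 * Real.exp (2 * t) * ‖𝔣 k‖ ^ 2 := by ring
        rw [← e]
        exact h
      have hdiff : DifferentiableAt ℝ χ₁ (Real.exp (2 * t) * ‖𝔣 k‖ ^ 2) :=
        ((hχ.smooth.differentiableOn (by simp)) _ hx.le).differentiableAt (Ici_mem_nhds hx)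
      have h_comp : HasDerivAt (fun s : ℝ => χ₁ (Real.exp (2 * s) * ‖𝔣 k‖ ^ 2))
          (deriv χ₁ (Real.exp (2 * t) * ‖𝔣 k‖ ^ 2) * (2 * Real.exp (2 * t) * ‖𝔣 k‖ ^ 2)) t :=
        hdiff.hasDerivAt.comp t h_inner
      exact h_comp.ofReal_comp.const_mul (𝔣 k)

variable [Fintype Λs]

/-- **(4.14) for the printed cutoff, per fixed momentum lattice**: `ε_* Σ_{k ∈ Λ*} |f_t(k)| ≤ (ε_* |Λ*|) e^{-t}` — the
hypothesis `∫_{Λ*} dk |D̂_t(k)| ≤ Δ₁ e^{-t}` of Theorem 1 (F7b `TruncatedPowerCounting`) with `Δ₁ = ε_*|Λ*|`, for EVERY `𝔣`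
(finding P3-2: lattice-dependent constant; the printed `L`-uniform intent is the GAP recorded in the module docstring).
[cite: Salmhofer1998, Proposition 3 (p.15 L136–150) and (4.14) (p.15 L15–18)] -/
theorem einnorm_pointCutoff (hχ : IsCutoff χ₁) {εs : ℝ} (hεs : 0 ≤ εs) (k0 : Λs) (𝔣 : Λs → ℂ) (t : ℝ) :
    εs * ∑ k : Λs, ‖pointCutoff χ₁ k0 𝔣 t k‖ ≤ εs * Fintype.card Λs * Real.exp (-t) := by
  calc εs * ∑ k : Λs, ‖pointCutoff χ₁ k0 𝔣 t k‖ ≤ εs * ∑ _k : Λs, Real.exp (-t) := by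
        gcongr with k
        exact norm_pointCutoff_le hχ k0 𝔣 t k
    _ = εs * Fintype.card Λs * Real.exp (-t) := by
        rw [Finset.sum_const, Finset.card_univ, nsmul_eq_mul]; ring

/-- The momentum-space half of (4.15) for the printed cutoff: `ε_* Σ_{k ∈ Λ*} |∂_t f_t(k)| ≤ 4 ε_* |Λ*| e^{-t}` (whence, per
fixed `Γ`, `‖Ḋ_t‖ ≤ 4ε|Γ|ε_*|Λ*| e^{-t} ≤ Δ₂ e^{t}` by `|χ_k(x)| = 1` and `|M_{σσ'}| ≤ 1` — not typed).
[cite: Salmhofer1998, Proposition 3 (p.15 L136–150) and (4.15) (p.15 L20–23)] -/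
theorem sum_norm_pointCutoffDot_le (hχ : IsCutoff χ₁) {εs : ℝ} (hεs : 0 ≤ εs) (k0 : Λs) (𝔣 : Λs → ℂ) (t : ℝ) :
    εs * ∑ k : Λs, ‖pointCutoffDot χ₁ k0 𝔣 t k‖ ≤ 4 * (εs * Fintype.card Λs) * Real.exp (-t) := by
  calc εs * ∑ k : Λs, ‖pointCutoffDot χ₁ k0 𝔣 t k‖ ≤ εs * ∑ _k : Λs, 4 * Real.exp (-t) := by
        gcongr with k
        exact norm_pointCutoffDot_le hχ k0 𝔣 t k
    _ = 4 * (εs * Fintype.card Λs) * Real.exp (-t) := by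
        rw [Finset.sum_const, Finset.card_univ, nsmul_eq_mul]; ring

end PointSingularity

end Salmhofer1998

end Literature.MathematicalPhysics.QuantumLattice.FermiRG
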